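import Literature.NumberTheory.GaloisRepresentations.StableSubspaceSaturation
import Literature.NumberTheory.GaloisRepresentations.StableLatticeValuationRing
import Literature.NumberTheory.GaloisRepresentations.AbsGaloisGroupCompact
import Literature.RepresentationTheory.Semisimple.IrreducibleOfCharpoly
import HarnessLib

/-!
# A representation with irreducible (semisimplified) reduction is irreducible — every rank

Topic `Literature/NumberTheory/GaloisRepresentations`.  Theorems only (no definitions, no named
facts).  Let `O ⊆ F` be a valuation subring (no Noetherian hypothesis: e.g. the valuation ring
`ℤ̄_ℓ` of `ℚ̄_ℓ`, `padicAlgClIntegers`), `ρ : G → GL_n(F)` a homomorphism with an integral model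
`ρ₀ : G → GL_n(O)` (`IsIntegralModelOf`; it exists for `G` compact, `O` open and `ρ` continuous,
`exists_integralModel_of_valuationSubring`), and `σ : G → GL_n(k)` a representation over a
field `k` having the residual characteristic polynomials of `ρ` along a residue embedding
`ι : O/𝔪 →+* k` (`HasResidualCharpolys ι ρ σ`: `det(X - σ(g)) = det(X - ρ(g)) mod 𝔪`; every
reduction and every residual representation `ρ̄^{ss}` of `ρ` qualifies).  **If `σ` is irreducible
then `ρ` is irreducible** (Darmon–Diamond–Taylor, *Fermat's Last Theorem* (1995), §2.1; the
standard remark "`ρ̄` irreducible ⇒ `ρ` irreducible" behind every modularity lifting theorem).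

Proof: `ρ ≅ ρ₀ ⊗ F`; a proper non-zero stable subspace of `Fⁿ` saturates in `Oⁿ`
(`exists_blocks_of_subrepresentation_valuationSubring`, file `StableSubspaceSaturation`), giving
`A : G → GL_m(O)`, `D : G → GL_p(O)`, `m, p > 0`, with
`det(X - ρ₀(g)) = det(X - A(g)) det(X - D(g))`;
reducing modulo `𝔪`, `det(X - σ(g)) = det(X - Ā(g)) det(X - D̄(g))`, and a representation whose
characteristic polynomials so factor is reducible (Brauer–Nesbitt over an arbitrary field:
`Literature.RepresentationTheory.Semisimple.not_isIrreducible_of_charpoly_eq_mul`).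

## Main results (all proved)

* `HasResidualCharpolys.isIrreducible_of_isIntegralModelOf`, `HasResidualCharpolys.isIrreducible`
  (continuous `ρ`, compact `G`, open `O`), `IsReductionOf.isIrreducible_of_isIrreducible`,
  `IsResidualRepOf.isIrreducible_of_isIrreducible` — the theorem and its usual wrappers.
* `FramedGaloisRep.isIrreducible_of_hasResidualCharpolys` — the case `ρ : Γ_K → GL_n(ℚ̄_ℓ)`,
  `O = ℤ̄_ℓ`.

## References

* H. Darmon, F. Diamond, R. Taylor, *Fermat's Last Theorem*, CDM 1995, §2.1.
  [DarmonDiamondTaylor1995]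
* J.-P. Serre, *Abelian ℓ-adic representations and elliptic curves* (1968), Ch. I §1.1.
  [SerreAbelianLadic1968]
-/

noncomputable section

open scoped MatrixGroups NNReal
open Matrix Module IsLocalRing
open Literature.RepresentationTheory.Semisimple

namespace Literature.NumberTheory.GaloisRepresentations

universe u v w

/-! ### Irreducible reduction implies irreducible -/

section Irreducible

variable {F : Type u} [Field F] {O : ValuationSubring F} {n : ℕ} {G : Type v} [Group G]
variable {k : Type w} [Field k] {ι : ResidueField O →+* k}

/-- The `g`-component of `glRepresentation σ` is `Matrix.toLin'` of the matrix `σ(g)`. [folklore] -/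
theorem glRepresentation_apply_eq_toLin' {L : Type*} [Field L] (σ : G →* GL (Fin n) L) (g : G) :
    (glRepresentation σ g : (Fin n → L) →ₗ[L] (Fin n → L)) =
      Matrix.toLin' ((σ g : GL (Fin n) L) : Matrix (Fin n) (Fin n) L) :=
  LinearMap.ext fun v ↦ by rw [Matrix.toLin'_apply]; rfl

/-- **Conjugate matrix representations are equivalent**: if `ρ₁(g) = P⁻¹ ρ(g) P` for all `g`,
then `v ↦ P v` is an equivalence from the representation on `Lⁿ` through `ρ₁` to the one through
`ρ` (Mathlib `Representation.Equiv`). [folklore] -/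
theorem nonempty_equiv_glRepresentation_of_conj {L : Type*} [Field L] {ρ ρ₁ : G →* GL (Fin n) L}
    (P : GL (Fin n) L) (hP : ∀ g, ρ₁ g = P⁻¹ * ρ g * P) :
    Nonempty ((glRepresentation ρ₁).Equiv (glRepresentation ρ)) := by
  let E : (Fin n → L) ≃ₗ[L] (Fin n → L) :=
    (P : Matrix (Fin n) (Fin n) L).toLinearEquiv' (Units.invertible P)
  refine ⟨Representation.Equiv.mk E fun g ↦ ?_⟩
  rw [Matrix.toLinearEquiv'_apply, glRepresentation_apply_eq_toLin',
    glRepresentation_apply_eq_toLin', ← Matrix.toLin'_mul, ← Matrix.toLin'_mul, hP g,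
    Units.val_mul, Units.val_mul, ← Matrix.mul_assoc, ← Matrix.mul_assoc, Units.mul_inv,
    Matrix.one_mul]

/-- **A representation with an irreducible reduction is irreducible** (Darmon–Diamond–Taylor
1995, §2.1), general form: let `ρ : G → GL_n(F)` have an integral model `ρ₀` over the valuation
subring `O ⊆ F`, and let `σ : G → GL_n(k)` have the residual characteristic polynomials of `ρ`
along `ι : O/𝔪 →+* k` (`HasResidualCharpolys`; e.g. any reduction, or any residual
representation `ρ̄^{ss}`, of `ρ`, pushed into any extension `k`).  If `σ` is irreducible, so is
`ρ`.  Proof: `ρ ≅ ρ₀ ⊗ F` (conjugation by the lattice basis); were `ρ₀ ⊗ F` reducible, saturation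
(`exists_blocks_of_subrepresentation_valuationSubring`) would give `A : G → GL_m(O)`,
`D : G → GL_p(O)`, `m, p > 0`, with `det(X - ρ₀(g)) = det(X - A(g)) det(X - D(g))`, whence
`det(X - σ(g)) = det(X - Ā(g)) det(X - D̄(g))` for the reductions `Ā`, `D̄`, and `σ` would be
reducible (`not_isIrreducible_of_charpoly_eq_mul`, Brauer–Nesbitt).
[cite: DarmonDiamondTaylor1995, §2.1] -/
theorem HasResidualCharpolys.isIrreducible_of_isIntegralModelOf {ρ : G →* GL (Fin n) F}
    {ρ₀ : G →* GL (Fin n) O} (hmodel : IsIntegralModelOf ρ ρ₀) {σ : G →* GL (Fin n) k}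
    (h : HasResidualCharpolys ι ρ σ) (hσ : (glRepresentation σ).IsIrreducible) :
    (glRepresentation ρ).IsIrreducible := by
  classical
  obtain ⟨P, hP⟩ := hmodel
  set ρ₁ : G →* GL (Fin n) F := (Matrix.GeneralLinearGroup.map O.subtype).comp ρ₀ with hρ₁
  -- `σ` lives on a non-zero space, so `n > 0` and `Fⁿ ≠ 0`
  haveI := hσ
  haveI : Nontrivial (Fin n → k) := Representation.nontrivial_of_isIrreducible (glRepresentation σ)
  haveI : Nonempty (Fin n) := by
    by_contra hn
    rw [not_nonempty_iff] at hn
    exact not_subsingleton (Fin n → k) inferInstance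
  -- the generic fibre `ρ₁ = ρ₀ ⊗ F` of the integral model is irreducible
  have h1 : (glRepresentation ρ₁).IsIrreducible := by
    have hbot : (⊥ : Subrepresentation (glRepresentation ρ₁)).toSubmodule = ⊥ := rfl
    have htop : (⊤ : Subrepresentation (glRepresentation ρ₁)).toSubmodule = ⊤ := rfl
    haveI : Nontrivial (Subrepresentation (glRepresentation ρ₁)) := ⟨⟨⊥, ⊤, fun e ↦ by
      have e' := congrArg Subrepresentation.toSubmodule e
      rw [hbot, htop] at e'
      exact bot_ne_top e'⟩⟩
    by_contra hirr
    obtain ⟨W, hW0, hW1⟩ : ∃ W : Subrepresentation (glRepresentation ρ₁), W ≠ ⊥ ∧ W ≠ ⊤ := by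
      by_contra hW
      push Not at hW
      exact hirr ⟨fun W ↦ or_iff_not_imp_left.mpr (hW W)⟩
    obtain ⟨m, p, hm, hp, -, A, D, hAD⟩ :=
      exists_blocks_of_subrepresentation_valuationSubring ρ₀ W hW0 hW1
    have hcp : ∀ g, ((σ g : GL (Fin n) k) : Matrix (Fin n) (Fin n) k).charpoly =
        ((integralReduction ι A g : GL (Fin m) k) : Matrix (Fin m) (Fin m) k).charpoly *
          ((integralReduction ι D g : GL (Fin p) k) : Matrix (Fin p) (Fin p) k).charpoly := by
      intro g
      obtain ⟨Q, hQ1, hQ2⟩ := h g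
      have hQ : Q = ((ρ₀ g : GL (Fin n) O) : Matrix (Fin n) (Fin n) O).charpoly :=
        Polynomial.map_injective O.subtype O.subtype_injective
          (hQ1.trans (IsIntegralModelOf.charpoly_map ⟨P, hP⟩ g).symm)
      rw [← hQ2, hQ, hAD g, Polynomial.map_mul, charpoly_integralReduction,
        charpoly_integralReduction]
    exact not_isIrreducible_of_charpoly_eq_mul hm hp σ _ _ hcp hσ
  -- transport along the conjugation `ρ₁ = P⁻¹ ρ P`
  haveI := h1
  obtain ⟨e⟩ := nonempty_equiv_glRepresentation_of_conj (ρ := ρ) (ρ₁ := ρ₁) P hP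
  exact Representation.isIrreducible_of_equiv e

variable [TopologicalSpace F] [TopologicalSpace G] [IsTopologicalGroup G] [CompactSpace G]

/-- **A continuous representation of a compact group with an irreducible reduction is
irreducible**: for `O ⊆ F` an open valuation subring, `G` compact, `ρ : G →ₜ* GL_n(F)` continuous
(so that integral models exist, `exists_integralModel_of_valuationSubring`) and `σ : G → GL_n(k)`
irreducible with the residual characteristic polynomials of `ρ`, the representation `ρ` on `Fⁿ`
is irreducible. [cite: DarmonDiamondTaylor1995, §2.1] -/
theorem HasResidualCharpolys.isIrreducible (hO : IsOpen (O : Set F)) (ρ : G →ₜ* GL (Fin n) F)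
    {σ : G →* GL (Fin n) k} (h : HasResidualCharpolys ι (ρ : G →* GL (Fin n) F) σ)
    (hσ : (glRepresentation σ).IsIrreducible) :
    (glRepresentation (ρ : G →* GL (Fin n) F)).IsIrreducible := by
  obtain ⟨P, ρ₀, hρ₀⟩ := exists_integralModel_of_valuationSubring hO ρ
  exact h.isIrreducible_of_isIntegralModelOf ⟨P, hρ₀⟩ hσ

omit [TopologicalSpace F] [TopologicalSpace G] [IsTopologicalGroup G] [CompactSpace G] in
/-- **`ρ̄` irreducible ⇒ `ρ` irreducible**, for a reduction `ρ̄` of `ρ` (`IsReductionOf`), pushed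
into any extension `k` of the residue field. [cite: DarmonDiamondTaylor1995, §2.1] -/
theorem IsReductionOf.isIrreducible_of_isIrreducible {ρ : G →* GL (Fin n) F} {τ : G →* GL (Fin n) k}
    (h : IsReductionOf ι ρ τ) (hτ : (glRepresentation τ).IsIrreducible) :
    (glRepresentation ρ).IsIrreducible := by
  obtain ⟨ρ₀, Q, hmodel, -⟩ := id h
  exact h.hasResidualCharpolys.isIrreducible_of_isIntegralModelOf hmodel hτ

omit [TopologicalSpace F] [TopologicalSpace G] [IsTopologicalGroup G] [CompactSpace G] in
/-- **`ρ̄^{ss}` irreducible ⇒ `ρ` irreducible**, for a residual representation `ρ̄^{ss}` of `ρ`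
(`IsResidualRepOf`, the semisimplification of a reduction), over any extension `k` of the residue
field. [cite: DarmonDiamondTaylor1995, §2.1] -/
theorem IsResidualRepOf.isIrreducible_of_isIrreducible {ρ : G →* GL (Fin n) F}
    {τ : G →* GL (Fin n) k} (h : IsResidualRepOf ι ρ τ) (hτ : (glRepresentation τ).IsIrreducible) :
    (glRepresentation ρ).IsIrreducible := by
  obtain ⟨τ₀, ⟨ρ₀, Q, hmodel, -⟩, -⟩ := id h
  exact h.hasResidualCharpolys.isIrreducible_of_isIntegralModelOf hmodel hτ

end Irreducible

/-! ### The `ℚ̄_ℓ` case -/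

section PadicAlgCl

variable {K : Type*} [Field K] {ℓ : ℕ} [Fact ℓ.Prime] {n : ℕ} {k : Type*} [Field k]

/-- **An `ℓ`-adic Galois representation with irreducible reduction is irreducible.**  Let
`ρ : Γ_K → GL_n(ℚ̄_ℓ)` be continuous, `ι : ℤ̄_ℓ/𝔪 →+* k` a residue embedding and
`σ : Γ_K → GL_n(k)` a representation with the residual characteristic polynomials of `ρ`
(`det(X - σ(g)) = ι(det(X - ρ(g)) mod 𝔪)`; e.g. `σ = ρ̄ ⊗ k` or `ρ̄^{ss} ⊗ k`).  If `σ` is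
irreducible then `ρ` is irreducible (`Γ_K` is compact in every characteristic,
`absoluteGaloisGroup_compactSpace`, and `ℤ̄_ℓ` is open in `ℚ̄_ℓ`, so integral models exist;
`HasResidualCharpolys.isIrreducible`). [cite: DarmonDiamondTaylor1995, §2.1] -/
theorem FramedGaloisRep.isIrreducible_of_hasResidualCharpolys
    (ρ : FramedGaloisRep K (PadicAlgCl ℓ) n)
    {ι : padicAlgClResidueField ℓ →+* k} {σ : Field.absoluteGaloisGroup K →* GL (Fin n) k}
    (h : HasResidualCharpolys ι (ρ : Field.absoluteGaloisGroup K →* GL (Fin n) (PadicAlgCl ℓ)) σ)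
    (hσ : (glRepresentation σ).IsIrreducible) : ρ.IsIrreducible := by
  haveI : CompactSpace (Field.absoluteGaloisGroup K) := absoluteGaloisGroup_compactSpace K
  have hO : IsOpen ((padicAlgClIntegers ℓ : ValuationSubring (PadicAlgCl ℓ)) :
      Set (PadicAlgCl ℓ)) := Valued.isOpen_valuationSubring _
  exact h.isIrreducible hO ρ hσ

end PadicAlgCl

end Literature.NumberTheory.GaloisRepresentations
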